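import Summits.HodgeConjecture.CorCM.MumfordTateRankFour
import Literature.AlgebraicGeometry.HodgeTheory.Sl2IsotypicDivisorClasses
import HarnessLib

/-!
# `dim MT(H¹(X)) ≤ 4` and `X` not of CM type: `B•(B) = D•(B) ⊗ ℂ` and the Hodge conjecture for `X`, for all its powers
# and for every abelian variety with an `X`-slot structure (Murty 1984 / Hazama 1984; Gordon Thm. 7.5, §7.3.2)

COR-CM (cell `pub-hodgecm2`, seat `b27` gen 31, count-neutral lane MT-RANK-FOUR-DIVISORS; theorems only, no definition,
no named fact; UNCONDITIONAL — nothing here uses or asserts HC_CM).  Sequel of `CorCM/MumfordTateRankFour` /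
`MumfordTateRankFourHodge` / `MumfordTateRankFourFactorDimension` (gen 30): there, a complex abelian variety `X` NOT of CM
type with `dim MT(H¹(X)) ≤ 4` was shown to satisfy `dim MT = 4`, `dim Hg = 3`, `Lie Hg ⊗ ℂ ≅ 𝔰𝔩₂` acting isotypically on
`H¹(X) ⊗ ℂ ≅ H^{1,0} ⊗ std`, `dim_ℚ End⁰(X) = (dim X)²`, `X ∼ B₀^{m+1}` with `B₀` simple of dimension `1` (non-CM
elliptic curve) or `2` (`End⁰(B₀)` a quaternion algebra), and the Hodge conjecture for `X` was derived only when `X` has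
an elliptic isogeny factor or odd dimension.  THIS FILE removes those hypotheses:

* **`isDivisorGenerated_and_hodgeConjectureFor_of_not_isOfCMType_of_mtRank_le_four`** — for such an `X` and EVERY
  abelian variety `B` with an `X`-slot structure (`AVSlots X B g`: `g_j : B → X` with `dim B = n dim X` and
  `H¹(B) = Σ g_j^* H¹(X)`; e.g. every power `X^{N+1}`): `B•(B) = D•(B) ⊗ ℂ` (`IsDivisorGenerated B`) and the Hodge
  conjecture holds for `B` (`HodgeConjectureFor B.dim B.X`);
* **`isDivisorGenerated_and_hodgeConjectureFor_self_of_not_isOfCMType_of_mtRank_le_four`** — in particular for `X`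
  itself: **the Hodge conjecture holds for every complex abelian variety `X` with `dim MT(H¹(X)) ≤ 4` that is not of CM
  type** (with gen 29's `hodgeConjectureFor_powSucc_of_mtRank_le_three`: for every `X` with `dim MT(H¹X) ≤ 3`, and for
  every non-CM `X` with `dim MT(H¹X) = 4`; the remaining case `dim MT = 4` of CM type is the first degenerate CM case);
* `isDivisorGenerated_and_hodgeConjectureFor_powSucc_of_not_isOfCMType_of_mtRank_le_four` — ALL POWERS `X^{N+1}`
  (`X` is stably nondegenerate, Gordon Def. 7.6), and `…_of_isIsogenous_powSucc_…` — their isogeny classes; this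
  covers all powers of every non-CM elliptic curve (the tree's Tate theorem `EllipticCurve.hodgeConjectureFor_powSucc`)
  AND all powers of every abelian surface with quaternionic multiplication realised as such an `X` (Murty's type (H);
  Moonen–Zarhin Type II(1)), with ONE proof and without Albert's classification.

The mathematics is the Literature lane `HodgeTheory/Sl2Isotypic{Letters, InvariantCoefficients, WordLemmas, CrossedClasses,
DivisorClasses}` (Murty's invariant-theory proof: `Lie Hg ⊗ ℂ ≅ 𝔰𝔩₂`, "all invariants are generated by those of degree
`2`", Gordon §7.3.2) over `Motives/HodgeThetaSubalgebraRankThree` (the Lie step, Deligne LNM 900 I §3); this file only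
translates the hypotheses `¬ IsOfCMType X`, `dim MT(H¹X) ≤ 4` into `Lie Hg ⊄ End_Hdg`, `dim Lie Hg ≤ 3`
(`isOfCMType_iff_mumfordTateLieAlgebra_le_endAlg`, `hodgeLie_le_endAlg_iff`, `finrank_hodgeLie_add_one_le_mtRank`).

## References

* [Gordon1997] B. B. Gordon, *A survey of the Hodge conjecture for abelian varieties*, App. B of Lewis, CRM Monogr.
  Ser. 10 (1999) = arXiv:alg-geom/9709030, Thm. 7.5 (Murty 1984 [B.82] / Hazama 1984 [B.47]), Def. 7.6, §7.3.2.
* [MoonenZarhin1999LowDim] B. Moonen, Yu. Zarhin, *Hodge classes on abelian varieties of low dimension*, Math. Ann.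
  315 (1999), §2 (2.1)–(2.2).
* [vanGeemen1994HodgeAV] B. van Geemen, LNM 1594 (1994), §2.4–2.5, Lemma 3.7, Thm. 4.3.
-/

noncomputable section

open CategoryTheory CategoryTheory.Limits Module

namespace Summit.HodgeConjecture.CorCM

open Literature.AlgebraicGeometry.Motives
open Literature.AlgebraicGeometry.Motives.AbelianVariety
open Literature.AlgebraicGeometry.Motives.HodgeStructure
open Literature.AlgebraicGeometry.HodgeTheory
open Literature.AlgebraicGeometry.Milne1999 (IsOfCMType)

variable [HodgeTensorFacts.{0, 0}] {X B : AbelianVariety ℂ} {n m : ℕ} {g : Fin m → (B ⟶ X)}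

/-- **Translation of the hypotheses**: `X` not of CM type and `dim MT(H¹(X)) ≤ 4` give `Lie Hg(H¹X) ⊄ End_Hdg(H¹X)` and
`dim_ℚ Lie Hg(H¹X) ≤ 3` (`isOfCMType_iff_mumfordTateLieAlgebra_le_endAlg`, `hodgeLie_le_endAlg_iff`,
`dim Hg + 1 ≤ dim MT`). [cite: MoonenZarhin1999LowDim, §2] -/
theorem not_hodgeLie_le_endAlg_and_finrank_le_three_of_not_isOfCMType (hX : IsSmoothProjective n X.X) (h0 : 0 < X.dim)
    (hcm : ¬ IsOfCMType X)
    (h4 : haveI := BettiUniverse.finite hX 1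
      (BettiUniverse.hodge exists_isReal_hodgeModel_holds hX 1).mtRank ≤ 4) :
    haveI := BettiUniverse.finite hX 1
    ¬ (BettiUniverse.hodge exists_isReal_hodgeModel_holds hX 1).hodgeLie ≤
        Subalgebra.toSubmodule (BettiUniverse.hodge exists_isReal_hodgeModel_holds hX 1).endAlg ∧
      Module.finrank ℚ (BettiUniverse.hodge exists_isReal_hodgeModel_holds hX 1).hodgeLie ≤ 3 := by
  haveI := BettiUniverse.finite hX 1
  haveI := nontrivial_bettiCohomology_one h0
  set H := BettiUniverse.hodge exists_isReal_hodgeModel_holds hX 1 with hH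
  obtain ⟨ψ⟩ := BettiUniverse.hodge_isPolarizable exists_isReal_hodgeModel_holds hX 1
  have hne : ¬ H.hodgeLie ≤ Subalgebra.toSubmodule H.endAlg := fun h =>
    hcm ((isOfCMType_iff_mumfordTateLieAlgebra_le_endAlg hX).2 ((hodgeLie_le_endAlg_iff H).1 h))
  have hle := finrank_hodgeLie_add_one_le_mtRank H ψ (by simp)
  exact ⟨hne, by omega⟩

/-- **`B•(B) = D•(B) ⊗ ℂ` and the Hodge conjecture for every abelian variety `B` with an `X`-slot structure, `X` not of
CM type with `dim MT(H¹(X)) ≤ 4`** (all powers of `X`, products of its powers in any bracketing): Murty 1984 / Hazama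
1984 (`rank Hg(X)_ℂ = rdim X = 1` ⟹ `Hdg = Div` on all powers), here fact-free through
`AVSlots.isDivisorGenerated_of_finrank_hodgeLie_le_three`.  UNCONDITIONAL. [cite: Gordon1997, Thm. 7.5 and §7.3.2]
[cite: MoonenZarhin1999LowDim, §2 (2.1)–(2.2)] -/
theorem isDivisorGenerated_and_hodgeConjectureFor_of_not_isOfCMType_of_mtRank_le_four (hX : IsSmoothProjective n X.X)
    (h0 : 0 < X.dim) (hcm : ¬ IsOfCMType X)
    (h4 : haveI := BettiUniverse.finite hX 1
      (BettiUniverse.hodge exists_isReal_hodgeModel_holds hX 1).mtRank ≤ 4)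
    (hg : AVSlots X B g) : IsDivisorGenerated B ∧ HodgeConjectureFor B.dim B.X := by
  have hn : X.dim = n := schemeDim_eq_holds hX
  subst hn
  obtain ⟨hne, h3⟩ := not_hodgeLie_le_endAlg_and_finrank_le_three_of_not_isOfCMType hX h0 hcm h4
  exact ⟨hg.isDivisorGenerated_of_finrank_hodgeLie_le_three hne h3,
    hg.hodgeConjectureFor_of_finrank_hodgeLie_le_three hne h3⟩

/-- **The Hodge conjecture for every complex abelian variety `X` with `dim MT(H¹(X)) ≤ 4` that is not of CM type**, and
`B•(X) = D•(X) ⊗ ℂ` — removing the elliptic-factor / odd-dimension hypotheses of gen 30's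
`hodgeConjectureFor_of_avDominatedBy_elliptic_of_mtRank_le_four` / `hodgeConjectureFor_of_not_isOfCMType_of_odd_dim`
(the case `X ∼ S^{m+1}`, `S` a QM abelian surface, included).  UNCONDITIONAL. [cite: Gordon1997, Thm. 7.5 and §7.3.2]
[cite: MoonenZarhin1999LowDim, §2 (2.1)–(2.2)] -/
theorem isDivisorGenerated_and_hodgeConjectureFor_self_of_not_isOfCMType_of_mtRank_le_four
    (hX : IsSmoothProjective n X.X) (h0 : 0 < X.dim) (hcm : ¬ IsOfCMType X)
    (h4 : haveI := BettiUniverse.finite hX 1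
      (BettiUniverse.hodge exists_isReal_hodgeModel_holds hX 1).mtRank ≤ 4) :
    IsDivisorGenerated X ∧ HodgeConjectureFor X.dim X.X :=
  isDivisorGenerated_and_hodgeConjectureFor_of_not_isOfCMType_of_mtRank_le_four hX h0 hcm h4 (avSlots_self X)

/-- **All powers**: `B•(X^{N+1}) = D•(X^{N+1}) ⊗ ℂ` and the Hodge conjecture for `X^{N+1}`, `X` not of CM type with
`dim MT(H¹(X)) ≤ 4` — `X` is STABLY NONDEGENERATE (Gordon Def. 7.6; Murty 1984 / Hazama 1984).  UNCONDITIONAL.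
[cite: Gordon1997, Thm. 7.5, Def. 7.6 and §7.3.2] -/
theorem isDivisorGenerated_and_hodgeConjectureFor_powSucc_of_not_isOfCMType_of_mtRank_le_four
    (hX : IsSmoothProjective n X.X) (h0 : 0 < X.dim) (hcm : ¬ IsOfCMType X)
    (h4 : haveI := BettiUniverse.finite hX 1
      (BettiUniverse.hodge exists_isReal_hodgeModel_holds hX 1).mtRank ≤ 4) (N : ℕ) :
    IsDivisorGenerated (X.powSucc N) ∧ HodgeConjectureFor (X.powSucc N).dim (X.powSucc N).X :=
  isDivisorGenerated_and_hodgeConjectureFor_of_not_isOfCMType_of_mtRank_le_four hX h0 hcm h4 (AVSlots.powSucc X N)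

/-- **Isogeny classes of the powers**: every abelian variety isogenous to some `X^{N+1}`, `X` not of CM type with
`dim MT(H¹(X)) ≤ 4`, has `B = D` and satisfies the Hodge conjecture (van Geemen Lemma 3.7).  UNCONDITIONAL.
[cite: vanGeemen1994HodgeAV, §3.5–3.7 Lemma 3.7] [cite: Gordon1997, Thm. 7.5 and §7.3.2] -/
theorem isDivisorGenerated_and_hodgeConjectureFor_of_isIsogenous_powSucc_of_not_isOfCMType_of_mtRank_le_four
    (hX : IsSmoothProjective n X.X) (h0 : 0 < X.dim) (hcm : ¬ IsOfCMType X)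
    (h4 : haveI := BettiUniverse.finite hX 1
      (BettiUniverse.hodge exists_isReal_hodgeModel_holds hX 1).mtRank ≤ 4)
    {A : AbelianVariety ℂ} {N : ℕ} (hA : A.IsIsogenous (X.powSucc N)) :
    IsDivisorGenerated A ∧ HodgeConjectureFor A.dim A.X := by
  obtain ⟨hD, hH⟩ := isDivisorGenerated_and_hodgeConjectureFor_powSucc_of_not_isOfCMType_of_mtRank_le_four hX h0 hcm h4 N
  exact ⟨IsDivisorGenerated.of_isIsogenous hA hD, HodgeConjectureFor.of_isIsogenous hA hH⟩

end Summit.HodgeConjecture.CorCM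

end
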